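import Summits.AtomisticToContinuum.HydrodynamicLimit.Theses.OneFlightGossipEngine
import Summits.AtomisticToContinuum.HydrodynamicLimit.Theorems.OneFlightGossipEngineClampedCurrentsDockCubicPathwise
import Summits.AtomisticToContinuum.HydrodynamicLimit.Theorems.ImplosionDichotomyHydroLimitInBandWindowContinuityFields
import Summits.AtomisticToContinuum.HydrodynamicLimit.Theorems.ImplosionDichotomyHydroLimitInBandWindowContinuityStreaming
import Literature.Analysis.FluidPDE.HardSphereFlowJointMeasurable
import Literature.MathematicalPhysics.KineticTheory.HardSphereEulerProofs
import HarnessLib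

/-!
# The cubic channel in expectation — preliminaries (stub `stub_cubicChannel`, QC-b, line `IdeatorTwoSketch`,
# crux `ClampedCurrentsDock`, stmt-AtomisticToContinuum-14680)

Helper file (`--supports stmt-AtomisticToContinuum-14680`) for the registered stub QC-b `stub_cubicChannel : CubicChannel`
(proved in the companion file `…CubicChannel.lean`, which imports this one). Contents:

* §1 the heat-flux coefficient field `b_s = ∇θ_s/(2θ_s²)` of a classical hard-sphere Euler solution is jointly smooth, hence on
  every compact slab `[0, t] × 𝕋³`, `t < T`, bounded and torus-Lipschitz uniformly in time, together with the bounds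
  `0 < θ_s ≤ θM`, `‖u_s‖ ≤ U` (`slab_package`; tools: the 9133 Fields file, `exists_lipschitz_slab`);
* §2 the flow shift of window functionals on the good set, `∫₀ʷ F(Φ_r(Φ_s z)) dr = ∫_s^{s+w} F(Φ_r z) dr` (any Banach range);
* §3 Tonelli over a window under the local Gibbs law (`lintegral_window_le`) and its instance for the cubic velocity tails
  (`cubicTailWindow_le`, registered: `E[∫_s^{s+w} Σ_i 1{M < ‖v_i‖}‖v_i‖³] ≤ w (N+1) e` from the per-time tails at accuracy `e`);
* §4 elementary pointwise inequalities of the cubic bookkeeping (peculiar vs. absolute third moments, the drift term, the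
  coherent term read in the normalisation of the weighted coherence input S6′);
* §5 the radial weight `R′ = (s′ − 5θ_s(x) − G_s(x, s′)) 1{K⋆² < s′}/C_R` fed to S6′: measurability in `(s, x, s′)`, vanishing
  below `K⋆²`, `|R′| ≤ |s′|`, and agreement with `R_s/C_R` on `[0, t]`;
* §6 the window length `w = τ (N+1)^{-1/3} → 0`.

prover-line-stmt-AtomisticToContinuum-14680-c2-0 (stub worker QC-b).
-/

noncomputable section

namespace Summit.AtomisticToContinuum.HydrodynamicLimit.Theorems.ClampedCurrentsDockCubicChannelPrelim

open scoped BigOperators ENNReal Classical Interval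
open MeasureTheory Filter Set Topology InformationTheory
open Literature.MathematicalPhysics.KineticTheory Literature.Analysis.FluidPDE Literature.Analysis.FunctionSpaces
open Summit.AtomisticToContinuum.HydrodynamicLimit.Theses.OneFlightGossipEngine
open Summit.AtomisticToContinuum.HydrodynamicLimit.Theorems
open Summit.AtomisticToContinuum.HydrodynamicLimit.Theorems.BoltzmannGreenKuboOrthMomentum
  (flowMod measurable_flowMod flowMod_of_mem)
open Summit.AtomisticToContinuum.HydrodynamicLimit.Theorems.HydroLimitInBandContinuity
  (measurable_flow_of_mem integrableOn_cubicSum exists_lipschitz_slab)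
open Summit.AtomisticToContinuum.HydrodynamicLimit.Theorems.EntropyClockDock (ae_mem_good_localGibbsLaw)

variable {σ : ℝ} {N : ℕ}

/-! ### §1 The heat-flux coefficient field on a compact slab -/

/-- The heat-flux coefficient field `b_s(x) = ∇θ_s(x)/(2θ_s(x)²) ∈ ℝ³` of the suprathermal remainder
`hi = (b·w) R(x, ‖w‖²)`. [folklore] -/
def bfield (θ : ℝ → T3 → ℝ) (s : ℝ) (x : T3) : V3 :=
  WithLp.toLp 2 fun k => Torus.partialDeriv k (θ s) x / (2 * (θ s x) ^ 2)

/-- Coordinates of `bfield`. [folklore] -/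
@[simp]
theorem bfield_apply (θ : ℝ → T3 → ℝ) (s : ℝ) (x : T3) (k : Fin 3) :
    bfield θ s x k = Torus.partialDeriv k (θ s) x / (2 * (θ s x) ^ 2) := rfl

/-- `bfield θ` is jointly smooth on `[0, T) × 𝕋³` for `θ` jointly smooth and positive there. [folklore] -/
theorem isSmoothSpaceTimeOn_bfield {T : ℝ} {θ : ℝ → T3 → ℝ} (hθ : Torus.IsSmoothSpaceTimeOn (Ico 0 T) θ)
    (hθ0 : ∀ t ∈ Ico 0 T, ∀ x, 0 < θ t x) : Torus.IsSmoothSpaceTimeOn (Ico 0 T) (bfield θ) := by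
  have hU : UniqueDiffOn ℝ (Ico (0 : ℝ) T) := uniqueDiffOn_Ico 0 T
  have hθ' : ∀ p ∈ Ico 0 T ×ˢ (univ : Set V3), 2 * Torus.stLift θ p ^ 2 ≠ 0 := fun p hp =>
    (mul_pos two_pos (pow_pos (hθ0 p.1 (mem_prod.1 hp).1 (Torus.proj p.2)) 2)).ne'
  show ContDiffOn ℝ _ (fun p : ℝ × V3 => (WithLp.toLp 2 fun k =>
    Torus.partialDeriv k (θ p.1) (Torus.proj p.2) / (2 * (θ p.1 (Torus.proj p.2)) ^ 2) : V3)) (Ico 0 T ×ˢ univ)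
  rw [contDiffOn_euclidean]
  intro k
  show ContDiffOn ℝ _ (fun p : ℝ × V3 => Torus.stLift (fun s => Torus.partialDeriv k (θ s)) p /
    (2 * Torus.stLift θ p ^ 2)) (Ico 0 T ×ˢ univ)
  exact (hθ.partialDeriv hU k).div (contDiffOn_const.mul (hθ.pow 2)) hθ'

/-- **Slab package.** Along a classical hard-sphere Euler solution on `[0, T)` and for `t ∈ [0, T)`: uniformly in
`s ∈ [0, t]`, the slices `θ_s, u_s, b_s` are continuous, `0 < θ_s ≤ θM`, `‖u_s‖ ≤ U`, `‖b_s‖ ≤ Bb` and `b_s` is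
torus-Lipschitz with constant `Lb` (joint smoothness on the compact slab `[0, (t+T)/2] × 𝕋³`, `exists_lipschitz_slab`).
[folklore] -/
theorem slab_package {σ T : ℝ} {ρ θ : ℝ → T3 → ℝ} {u : ℝ → T3 → V3} (hE : IsHardSphereEulerSolution σ T ρ u θ)
    {t : ℝ} (ht : t ∈ Ico 0 T) :
    ∃ θM U Bb Lb : ℝ, 0 ≤ θM ∧ 0 ≤ U ∧ 0 ≤ Bb ∧ 0 ≤ Lb ∧ ∀ s ∈ Icc 0 t,
      Continuous (θ s) ∧ Continuous (u s) ∧ Continuous (bfield θ s) ∧ (∀ x, 0 < θ s x) ∧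
      (∀ x, θ s x ≤ θM) ∧ (∀ x, ‖u s x‖ ≤ U) ∧ (∀ x, ‖bfield θ s x‖ ≤ Bb) ∧
      (∀ x y, ‖bfield θ s x - bfield θ s y‖ ≤ Lb * Torus.euclidDist x y) := by
  have ht₁ : 0 < (t + T) / 2 := by linarith [ht.1, ht.2]
  have ht₁T : (t + T) / 2 < T := by linarith [ht.2]
  have htt₁ : t ≤ (t + T) / 2 := by linarith [ht.2]
  have hsub : Icc 0 ((t + T) / 2) ⊆ Ico 0 T := Icc_subset_Ico_right ht₁T
  obtain ⟨Cθ, hCθ⟩ := hE.smooth_temperature.exists_norm_le_of_isCompact isCompact_Icc hsub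
  obtain ⟨Cu, hCu⟩ := hE.smooth_velocity.exists_norm_le_of_isCompact isCompact_Icc hsub
  have hb := isSmoothSpaceTimeOn_bfield hE.smooth_temperature hE.temperature_pos
  obtain ⟨Cb, hCb⟩ := hb.exists_norm_le_of_isCompact isCompact_Icc hsub
  obtain ⟨K, hK0, hK⟩ := exists_lipschitz_slab hb ht₁ ht₁T
  refine ⟨max Cθ 0, max Cu 0, max Cb 0, K, le_max_right _ _, le_max_right _ _, le_max_right _ _, hK0,
    fun s hs => ?_⟩
  have hs₁ : s ∈ Icc 0 ((t + T) / 2) := ⟨hs.1, hs.2.trans htt₁⟩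
  have hsT : s ∈ Ico 0 T := hsub hs₁
  refine ⟨(hE.smooth_temperature.isSmooth_slice hsT).continuous, (hE.smooth_velocity.isSmooth_slice hsT).continuous,
    (hb.isSmooth_slice hsT).continuous, hE.temperature_pos s hsT, fun x => ?_, fun x => ?_, fun x => ?_,
    fun x y => ?_⟩
  · have h := hCθ s hs₁ x
    rw [Real.norm_eq_abs] at h
    exact ((le_abs_self _).trans h).trans (le_max_left _ _)
  · exact (hCu s hs₁ x).trans (le_max_left _ _)
  · exact (hCb s hs₁ x).trans (le_max_left _ _)
  · have h := hK s hs₁ s hs₁ x y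
    rwa [sub_self, abs_zero, zero_add] at h

/-! ### §2 The flow shift of window functionals on the good set -/

/-- **Flow shift.** On the good set, `∫₀ʷ F(Φ_r(Φ_s z)) dr = ∫_s^{s+w} F(Φ_r z) dr` for every Banach-valued `F`
(group property `Φ_r ∘ Φ_s = Φ_{r+s}` and translation of the time variable). [folklore] -/
theorem integral_window_shift {E : Type*} [NormedAddCommGroup E] [NormedSpace ℝ E]
    (Φ : HardSphereFlow (Torus.geometry (Fin 3)) (hsDiameter σ N) (N + 1)) {z : Config (N + 1) (Fin 3) T3}
    (hz : z ∈ Φ.good) (F : Config (N + 1) (Fin 3) T3 → E) (s w : ℝ) :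
    ∫ r in (0 : ℝ)..w, F (Φ.flow r (Φ.flow s z)) = ∫ r in s..(s + w), F (Φ.flow r z) := by
  have h : ∀ r, Φ.flow r (Φ.flow s z) = Φ.flow (r + s) z := fun r => (Φ.flow_add r s z hz).symm
  simp_rw [h]
  rw [intervalIntegral.integral_comp_add_right (fun r => F (Φ.flow r z)) s, zero_add, add_comm w s]

/-! ### §3 Tonelli over a window under the local Gibbs law -/

variable {a₀ θ₀ : T3 → ℝ} {u₀ : T3 → V3}

/-- **Tonelli over a window.** For a measurable nonnegative configuration functional `f`, integrable in time along
good orbits, a per-time bound `E_λ[f(Φ_r ·)] ≤ B` on `[s, s+w]` integrates to `E_λ[∫_s^{s+w} f(Φ_r ·) dr] ≤ w B`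
(the flow modified off the good set is jointly measurable; the good set has full `λ`-measure). [folklore] -/
theorem lintegral_window_le (hσ2 : σ ≤ 1 / 2) (ha : Continuous a₀) (hθ : Continuous θ₀) (hu : Continuous u₀)
    (ha0 : ∀ x, 0 < a₀ x) (hθ0 : ∀ x, 0 < θ₀ x)
    (Φ : HardSphereFlow (Torus.geometry (Fin 3)) (hsDiameter σ N) (N + 1))
    {f : Config (N + 1) (Fin 3) T3 → ℝ} (hfm : Measurable f) (hf0 : ∀ c, 0 ≤ f c)
    (hfi : ∀ z ∈ Φ.good, ∀ a b : ℝ, IntegrableOn (fun r => f (Φ.flow r z)) (Ioc a b))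
    {B s w : ℝ} (hw : 0 ≤ w)
    (hbd : ∀ r ∈ Icc s (s + w), ∫⁻ z, ENNReal.ofReal (f (Φ.flow r z)) ∂(localGibbsLaw σ a₀ u₀ θ₀ N Φ) ≤
      ENNReal.ofReal B) :
    ∫⁻ z, ENNReal.ofReal (∫ r in s..(s + w), f (Φ.flow r z)) ∂(localGibbsLaw σ a₀ u₀ θ₀ N Φ) ≤
      ENNReal.ofReal (w * B) := by
  -- adapted from `ClampedCurrentsDockThirdMoment.stub_thirdMomentWindow`
  haveI := isProbabilityMeasure_localGibbsLaw ha hθ hu ha0 hθ0 hσ2 N Φ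
  have hsw : s ≤ s + w := le_add_of_nonneg_right hw
  set F : Config (N + 1) (Fin 3) T3 × ℝ → ℝ≥0∞ := fun p => ENNReal.ofReal (f (flowMod Φ (p.2, p.1))) with hF
  have hFm : Measurable F :=
    (hfm.comp ((measurable_flowMod Φ).comp (measurable_snd.prodMk measurable_fst))).ennreal_ofReal
  have hgood := ae_mem_good_localGibbsLaw σ a₀ θ₀ u₀ N Φ
  have h1 : ∀ᵐ z ∂(localGibbsLaw σ a₀ u₀ θ₀ N Φ),
      ENNReal.ofReal (∫ r in s..(s + w), f (Φ.flow r z)) = ∫⁻ r in Ioc s (s + w), F (z, r) := by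
    filter_upwards [hgood] with z hz
    rw [intervalIntegral.integral_of_le hsw,
      ofReal_integral_eq_lintegral_ofReal (hfi z hz s (s + w)) (ae_of_all _ fun r => hf0 _)]
    refine lintegral_congr fun r => ?_
    simp only [hF, flowMod_of_mem Φ hz]
  have h2 : ∫⁻ z, (∫⁻ r in Ioc s (s + w), F (z, r)) ∂(localGibbsLaw σ a₀ u₀ θ₀ N Φ) =
      ∫⁻ r in Ioc s (s + w), ∫⁻ z, F (z, r) ∂(localGibbsLaw σ a₀ u₀ θ₀ N Φ) :=
    lintegral_lintegral_swap hFm.aemeasurable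
  have h3 : ∀ r ∈ Ioc s (s + w), ∫⁻ z, F (z, r) ∂(localGibbsLaw σ a₀ u₀ θ₀ N Φ) ≤ ENNReal.ofReal B := by
    intro r hr
    calc ∫⁻ z, F (z, r) ∂(localGibbsLaw σ a₀ u₀ θ₀ N Φ)
        = ∫⁻ z, ENNReal.ofReal (f (Φ.flow r z)) ∂(localGibbsLaw σ a₀ u₀ θ₀ N Φ) := by
          refine lintegral_congr_ae ?_
          filter_upwards [hgood] with z hz
          simp only [hF, flowMod_of_mem Φ hz]
      _ ≤ ENNReal.ofReal B := hbd r ⟨hr.1.le, hr.2⟩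
  calc ∫⁻ z, ENNReal.ofReal (∫ r in s..(s + w), f (Φ.flow r z)) ∂(localGibbsLaw σ a₀ u₀ θ₀ N Φ)
      = ∫⁻ z, (∫⁻ r in Ioc s (s + w), F (z, r)) ∂(localGibbsLaw σ a₀ u₀ θ₀ N Φ) := lintegral_congr_ae h1
    _ = ∫⁻ r in Ioc s (s + w), ∫⁻ z, F (z, r) ∂(localGibbsLaw σ a₀ u₀ θ₀ N Φ) := h2
    _ ≤ ∫⁻ _r in Ioc s (s + w), ENNReal.ofReal B := setLIntegral_mono' measurableSet_Ioc h3
    _ = ENNReal.ofReal (w * B) := by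
        rw [setLIntegral_const, Real.volume_Ioc, add_sub_cancel_left, ← ENNReal.ofReal_mul' hw, mul_comm]

/-- The cubic velocity tail sum `Σ_i 1{M < ‖v_i‖}‖v_i‖³` as a configuration functional. [folklore] -/
def tailSum (N : ℕ) (M : ℝ) (c : Config (N + 1) (Fin 3) T3) : ℝ :=
  ∑ i, Set.indicator {v : V3 | M < ‖v‖} (fun v => ‖v‖ ^ 3) (c i).2

/-- `tailSum` is measurable. [folklore] -/
theorem measurable_tailSum (N : ℕ) (M : ℝ) : Measurable (tailSum N M) :=
  Finset.measurable_sum _ fun i _ =>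
    ((measurable_norm.pow_const 3).indicator (measurableSet_lt measurable_const measurable_norm)).comp
      (measurable_pi_apply i).snd

/-- `0 ≤ tailSum ≤ Σ_i ‖v_i‖³`. [folklore] -/
theorem tailSum_nonneg_le (N : ℕ) (M : ℝ) (c : Config (N + 1) (Fin 3) T3) :
    0 ≤ tailSum N M c ∧ tailSum N M c ≤ ∑ i, ‖(c i).2‖ ^ 3 := by
  refine ⟨Finset.sum_nonneg fun i _ => Set.indicator_nonneg (fun v _ => by positivity) _,
    Finset.sum_le_sum fun i _ => ?_⟩
  exact Set.indicator_le_self' (fun v _ => by positivity) _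

/-- Along a good orbit the tail sum is integrable in time on bounded windows (dominated by the cubic sum, which is
bounded by the conserved energy). [folklore] -/
theorem integrableOn_tailSum (Φ : HardSphereFlow (Torus.geometry (Fin 3)) (hsDiameter σ N) (N + 1)) (M : ℝ)
    {z : Config (N + 1) (Fin 3) T3} (hz : z ∈ Φ.good) (a b : ℝ) :
    IntegrableOn (fun r => tailSum N M (Φ.flow r z)) (Ioc a b) := by
  have hm : Measurable fun r => tailSum N M (Φ.flow r z) := (measurable_tailSum N M).comp (measurable_flow_of_mem Φ hz)
  refine Integrable.mono' (integrableOn_cubicSum Φ hz 1 a b) hm.aestronglyMeasurable (ae_of_all _ fun r => ?_)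
  rw [Real.norm_eq_abs, abs_of_nonneg (tailSum_nonneg_le N M _).1, one_mul]
  exact (tailSum_nonneg_le N M _).2.trans (Finset.sum_le_sum fun i _ => le_add_of_nonneg_left zero_le_one)

/-- registered support signature (QC-b, cubic tails over a window) of line IdeatorTwoSketch, crux ClampedCurrentsDock — route-internal, not a cited fact -/
def CubicTailWindow : Prop :=
  ∀ (σ : ℝ) (N : ℕ) (Φ : HardSphereFlow (Torus.geometry (Fin 3)) (hsDiameter σ N) (N + 1))
    (a₀ θ₀ : T3 → ℝ) (u₀ : T3 → V3) (M e s w : ℝ), 0 < σ → σ < 1 / 2 →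
    Continuous a₀ → Continuous θ₀ → Continuous u₀ → (∀ x, 0 < a₀ x) → (∀ x, 0 < θ₀ x) → 0 ≤ e → 0 ≤ w →
    (∀ r ∈ Set.Icc s (s + w), ∫⁻ z, ENNReal.ofReal (((N : ℝ) + 1)⁻¹ * ∑ i : Fin (N + 1),
        Set.indicator {v : V3 | M < ‖v‖} (fun v => ‖v‖ ^ 3) ((Φ.flow r z i).2)) ∂(localGibbsLaw σ a₀ u₀ θ₀ N Φ) ≤
        ENNReal.ofReal e) →
    ∫⁻ z, ENNReal.ofReal (∫ r in s..(s + w), ∑ i : Fin (N + 1),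
        Set.indicator {v : V3 | M < ‖v‖} (fun v => ‖v‖ ^ 3) ((Φ.flow r z i).2)) ∂(localGibbsLaw σ a₀ u₀ θ₀ N Φ) ≤
      ENNReal.ofReal (w * ((N : ℝ) + 1) * e)

/-- **Cubic velocity tails over a window under the true law** (registered support theorem of line `IdeatorTwoSketch`):
per-time tails `E_λ[(N+1)⁻¹ Σ_i 1{M < ‖v_i(r)‖}‖v_i(r)‖³] ≤ e` on `[s, s+w]` give
`E_λ[∫_s^{s+w} Σ_i 1{M < ‖v_i(r)‖}‖v_i(r)‖³ dr] ≤ w (N+1) e` (Tonelli on the good set). [folklore] -/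
theorem cubicTailWindow : CubicTailWindow := by
  intro σ N Φ a₀ θ₀ u₀ M e s w _hσ hσ2 ha hθ hu ha0 hθ0 he hw hbd
  have hN : (0 : ℝ) < (N : ℝ) + 1 := by positivity
  have hbd' : ∀ r ∈ Icc s (s + w), ∫⁻ z, ENNReal.ofReal (tailSum N M (Φ.flow r z)) ∂(localGibbsLaw σ a₀ u₀ θ₀ N Φ) ≤
      ENNReal.ofReal (((N : ℝ) + 1) * e) := by
    intro r hr
    have e1 : ∀ z, ENNReal.ofReal (tailSum N M (Φ.flow r z)) = ENNReal.ofReal ((N : ℝ) + 1) *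
        ENNReal.ofReal (((N : ℝ) + 1)⁻¹ * ∑ i : Fin (N + 1),
          Set.indicator {v : V3 | M < ‖v‖} (fun v => ‖v‖ ^ 3) ((Φ.flow r z i).2)) := by
      intro z
      rw [← ENNReal.ofReal_mul hN.le, ← mul_assoc, mul_inv_cancel₀ hN.ne', one_mul]
      rfl
    simp_rw [e1]
    rw [lintegral_const_mul' _ _ ENNReal.ofReal_ne_top, ENNReal.ofReal_mul hN.le]
    exact mul_le_mul' le_rfl (hbd r hr)
  have h := lintegral_window_le hσ2.le ha hθ hu ha0 hθ0 Φ (measurable_tailSum N M) (fun c => (tailSum_nonneg_le N M c).1)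
    (fun z hz a b => integrableOn_tailSum Φ M hz a b) hw hbd'
  rw [← mul_assoc] at h
  exact h

/-- The cubic tail functional is antitone in the level: raising `M ≤ M'` lowers the per-time tail. [folklore] -/
theorem lintegral_tail_mono (Φ : HardSphereFlow (Torus.geometry (Fin 3)) (hsDiameter σ N) (N + 1))
    (μ : Measure (Config (N + 1) (Fin 3) T3)) {M M' : ℝ} (hMM' : M ≤ M') (r : ℝ) :
    ∫⁻ z, ENNReal.ofReal (((N : ℝ) + 1)⁻¹ * ∑ i : Fin (N + 1),
        Set.indicator {v : V3 | M' < ‖v‖} (fun v => ‖v‖ ^ 3) ((Φ.flow r z i).2)) ∂μ ≤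
      ∫⁻ z, ENNReal.ofReal (((N : ℝ) + 1)⁻¹ * ∑ i : Fin (N + 1),
        Set.indicator {v : V3 | M < ‖v‖} (fun v => ‖v‖ ^ 3) ((Φ.flow r z i).2)) ∂μ := by
  refine lintegral_mono fun z => ENNReal.ofReal_le_ofReal (mul_le_mul_of_nonneg_left
    (Finset.sum_le_sum fun i _ => ?_) (inv_nonneg.2 (by positivity)))
  exact Set.indicator_le_indicator_of_subset (fun v (hv : M' < ‖v‖) => lt_of_le_of_lt hMM' hv)
    (fun v => by positivity) _

/-- **From a pathwise bound to a bound in mean.** If a.s. `|X| ≤ k₁ V + k₀ + k₃ T + k₂ B` with nonnegative constants,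
`V, T` a.e.-measurable, and the means of `V, T, B` (as lower integrals of `ofReal`) are bounded by `BV, BT, BB ≥ 0` under a
probability law, then `E[ofReal |X|] ≤ ofReal (k₁ BV + k₀ + k₃ BT + k₂ BB)` (the one possibly non-measurable term `B` is
integrated last, `lintegral_add_left'`). [folklore] -/
theorem lintegral_abs_le_of_pathwise {α : Type*} [MeasurableSpace α] {P : Measure α} [IsProbabilityMeasure P]
    {X V Tl Bq : α → ℝ} {k₁ k₀ k₃ k₂ BV BT BB : ℝ} (hk₁ : 0 ≤ k₁) (hk₀ : 0 ≤ k₀) (hk₃ : 0 ≤ k₃) (hk₂ : 0 ≤ k₂)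
    (hBV : 0 ≤ BV) (hBT : 0 ≤ BT) (hBB : 0 ≤ BB) (hVm : AEMeasurable V P) (hTm : AEMeasurable Tl P)
    (hpath : ∀ᵐ z ∂P, |X z| ≤ k₁ * V z + k₀ + k₃ * Tl z + k₂ * Bq z)
    (hV : ∫⁻ z, ENNReal.ofReal (V z) ∂P ≤ ENNReal.ofReal BV)
    (hT : ∫⁻ z, ENNReal.ofReal (Tl z) ∂P ≤ ENNReal.ofReal BT)
    (hB : ∫⁻ z, ENNReal.ofReal (Bq z) ∂P ≤ ENNReal.ofReal BB) :
    ∫⁻ z, ENNReal.ofReal |X z| ∂P ≤ ENNReal.ofReal (k₁ * BV + k₀ + k₃ * BT + k₂ * BB) := by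
  have hpt : ∀ᵐ z ∂P, ENNReal.ofReal |X z| ≤
      (ENNReal.ofReal k₁ * ENNReal.ofReal (V z) + ENNReal.ofReal k₀ + ENNReal.ofReal k₃ * ENNReal.ofReal (Tl z)) +
        ENNReal.ofReal k₂ * ENNReal.ofReal (Bq z) := by
    filter_upwards [hpath] with z hz
    calc ENNReal.ofReal |X z| ≤ ENNReal.ofReal (k₁ * V z + k₀ + k₃ * Tl z + k₂ * Bq z) := ENNReal.ofReal_le_ofReal hz
      _ ≤ ENNReal.ofReal (k₁ * V z + k₀ + k₃ * Tl z) + ENNReal.ofReal (k₂ * Bq z) := ENNReal.ofReal_add_le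
      _ ≤ ENNReal.ofReal (k₁ * V z + k₀) + ENNReal.ofReal (k₃ * Tl z) + ENNReal.ofReal (k₂ * Bq z) :=
          add_le_add ENNReal.ofReal_add_le le_rfl
      _ ≤ ENNReal.ofReal (k₁ * V z) + ENNReal.ofReal k₀ + ENNReal.ofReal (k₃ * Tl z) + ENNReal.ofReal (k₂ * Bq z) :=
          add_le_add (add_le_add ENNReal.ofReal_add_le le_rfl) le_rfl
      _ = _ := by rw [ENNReal.ofReal_mul hk₁, ENNReal.ofReal_mul hk₃, ENNReal.ofReal_mul hk₂]
  have hm : AEMeasurable (fun z => ENNReal.ofReal k₁ * ENNReal.ofReal (V z) + ENNReal.ofReal k₀ +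
      ENNReal.ofReal k₃ * ENNReal.ofReal (Tl z)) P :=
    ((hVm.ennreal_ofReal.const_mul _).add aemeasurable_const).add (hTm.ennreal_ofReal.const_mul _)
  have hm' : AEMeasurable (fun z => ENNReal.ofReal k₁ * ENNReal.ofReal (V z) + ENNReal.ofReal k₀) P :=
    (hVm.ennreal_ofReal.const_mul _).add aemeasurable_const
  calc ∫⁻ z, ENNReal.ofReal |X z| ∂P
      ≤ ∫⁻ z, ((ENNReal.ofReal k₁ * ENNReal.ofReal (V z) + ENNReal.ofReal k₀ +
          ENNReal.ofReal k₃ * ENNReal.ofReal (Tl z)) + ENNReal.ofReal k₂ * ENNReal.ofReal (Bq z)) ∂P :=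
        lintegral_mono_ae hpt
    _ = ENNReal.ofReal k₁ * ∫⁻ z, ENNReal.ofReal (V z) ∂P + ENNReal.ofReal k₀ +
          ENNReal.ofReal k₃ * ∫⁻ z, ENNReal.ofReal (Tl z) ∂P + ENNReal.ofReal k₂ * ∫⁻ z, ENNReal.ofReal (Bq z) ∂P := by
        rw [lintegral_add_left' hm, lintegral_add_left' hm', lintegral_add_left' (hVm.ennreal_ofReal.const_mul _),
          lintegral_const_mul'' _ hVm.ennreal_ofReal, lintegral_const_mul'' _ hTm.ennreal_ofReal,
          lintegral_const_mul' _ _ ENNReal.ofReal_ne_top, lintegral_const, measure_univ, mul_one]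
    _ ≤ ENNReal.ofReal k₁ * ENNReal.ofReal BV + ENNReal.ofReal k₀ + ENNReal.ofReal k₃ * ENNReal.ofReal BT +
          ENNReal.ofReal k₂ * ENNReal.ofReal BB := by
        gcongr
    _ = ENNReal.ofReal (k₁ * BV + k₀ + k₃ * BT + k₂ * BB) := by
        rw [← ENNReal.ofReal_mul hk₁, ← ENNReal.ofReal_mul hk₃, ← ENNReal.ofReal_mul hk₂,
          ← ENNReal.ofReal_add (by positivity) hk₀, ← ENNReal.ofReal_add (by positivity) (by positivity),
          ← ENNReal.ofReal_add (by positivity) (by positivity)]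

/-- Choice of small parameters: `a · ε/(8a + 8) ≤ ε/8`. [folklore] -/
theorem mul_frac_le {a ε : ℝ} (ha : 0 ≤ a) (hε : 0 ≤ ε) : a * (ε / (8 * a + 8)) ≤ ε / 8 := by
  rw [mul_div_assoc', div_le_div_iff₀ (by positivity) (by positivity)]
  nlinarith

/-! ### §4 The window length vanishes -/

/-- `w_N = τ (N+1)^{-1/3} → 0`. [folklore] -/
theorem tendsto_window_zero (τ : ℝ) :
    Tendsto (fun N : ℕ => τ * ((N : ℝ) + 1) ^ (-(1 / 3 : ℝ))) atTop (𝓝 0) := by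
  have h1 : Tendsto (fun N : ℕ => (N : ℝ) + 1) atTop atTop :=
    tendsto_atTop_add_const_right _ 1 tendsto_natCast_atTop_atTop
  have h2 := (tendsto_rpow_neg_atTop (by norm_num : (0 : ℝ) < 1 / 3)).comp h1
  have h3 := h2.const_mul τ
  rw [mul_zero] at h3
  exact h3

end Summit.AtomisticToContinuum.HydrodynamicLimit.Theorems.ClampedCurrentsDockCubicChannelPrelim

end
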